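import Mathlib.Logic.Denumerable
import Literature.Analysis.UnboundedOperators.HilbertPolya
import Literature.NumberTheory.LFunctions.RHWave0HardyProofs
import Literature.NumberTheory.LFunctions.WeilZeroSum
import HarnessLib

/-!
# The Hilbert–Pólya surrogate is equivalent to the Riemann Hypothesis — proved

Sibling proof file of `Literature/Analysis/UnboundedOperators/HilbertPolya.lean`. That file states
the *formal surrogate* `Literature.Analysis.UnboundedOperators.HilbertPolyaConjecture` (**rh.S38**):
"there is a self-adjoint diagonal operator on `ℓ²(ℕ, ℂ)` whose eigenvalues, with multiplicity, are
the ordinates `γ` of the non-trivial zeros `1/2 + iγ` of `ζ`". The informal Hilbert–Pólya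
conjecture (Pólya c. 1914; Berry–Keating, *SIAM Review* 41 (1999), §1, p. 238: "such
frequencies—real numbers—are discrete eigenvalues of a self-adjoint (hermitean) operator … an old
idea, going back at least to Hilbert and Polya") asks for a *natural* such operator and is not a
theorem of the literature; its surrogate is an OPEN statement and cannot be discharged. What this
file proves, sorry-free, is exactly why: the surrogate is *equivalent* to Mathlib's
`RiemannHypothesis`.

## Main results

* `IsHilbertPolyaSpectrum.riemannHypothesis`: a Hilbert–Pólya spectrum forces every non-trivial
  zero onto the critical line (the "self-adjoint ⇒ `Re ρ = 1/2`" direction).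
* `IsHilbertPolyaSpectrum.infinite_riemannZetaNontrivialZeros`: an infinite index type forces
  infinitely many non-trivial zeros; `infinite_of_hilbertBasis`: a Hilbert basis of `ℓ²(ℕ, ℂ)` has
  an infinite index type.
* `exists_isHilbertPolyaOperator_of_riemannHypothesis`: under RH, and given infinitely many
  non-trivial zeros, the tautological diagonal operator indexed by
  `Σ ρ ∈ {non-trivial zeros}, Fin (ord_ρ ζ)` (countably infinite, so it carries a Hilbert basis of
  `ℓ²(ℕ, ℂ)`) with symbol `Im ρ` is a Hilbert–Pólya operator.
* `hilbertPolyaConjecture_iff_riemannHypothesis_and_infinite`: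
  `HilbertPolyaConjecture ↔ RiemannHypothesis ∧ riemannZetaNontrivialZeros.Infinite` (pure glue);
* `hilbertPolyaConjecture_iff_riemannHypothesis`: `HilbertPolyaConjecture ↔ RiemannHypothesis`,
  unconditional, the infinitude of the non-trivial zeros being Hardy's theorem (1914), proved in
  tree as `Literature.NumberTheory.LFunctions.hardy_infinite_zeros_on_critical_line_holds`.
* `isHilbertPolyaSpectrum_iff_of_riemannHypothesis`: under RH the spectrum condition may be
  checked on the critical line only.

## References

* M. V. Berry, J. P. Keating, *The Riemann zeros and eigenvalue asymptotics*, SIAM Review 41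
  (1999) 236–266, §1 pp. 237–238 (the heuristic; no theorem is printed there).
* H. M. Edwards, *Riemann's Zeta Function* (1974), §11.1 p. 224 (Hardy 1914).
* The equivalence itself is folklore glue over the surrogate's definition; it is not a printed
  theorem.

## Design

No new definitions: the index type of the tautological operator is written inline as a `Σ`-type,
and the Hilbert basis it indexes is obtained by transporting the standard basis of `ℓ²(ℕ, ℂ)`
along a bijection with `ℕ` (`nonempty_equiv_of_countable`). Countability of the zero set is the
tree's `Literature.NumberTheory.LFunctions.riemannZetaNontrivialZeros_countable` (`WeilZeroSum.lean`), stated there for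
the byte-identical copy `ZetaZeros.riemannZetaNontrivialZeros` of
`RHWave0.riemannZetaNontrivialZeros` and transported by `rfl`.
-/

noncomputable section

open Complex Set
open scoped lp

namespace Literature.Analysis.UnboundedOperators

open Literature.NumberTheory.LFunctions Literature.NumberTheory.LFunctions.RHWave0

/-! ### The non-trivial zeros: membership and infinitude -/

/-- Membership in `riemannZetaNontrivialZeros`, unfolded: `ζ s = 0` and `s` is not a trivial zero
`-2(n+1)` (by definition of `Literature.NumberTheory.LFunctions.RHWave0.riemannZetaNontrivialZeros`). [folklore] -/
theorem mem_riemannZetaNontrivialZeros {s : ℂ} :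
    s ∈ riemannZetaNontrivialZeros ↔ riemannZeta s = 0 ∧ ¬∃ n : ℕ, s = -2 * (n + 1) := by
  simp only [RHWave0.riemannZetaNontrivialZeros, mem_sdiff, mem_riemannZetaZeros, mem_range,
    not_exists]
  constructor <;> rintro ⟨h0, h⟩ <;> exact ⟨h0, fun n hn => h n hn.symm⟩

/-- There are infinitely many non-trivial zeros of `ζ`. This is (a weakening of) Hardy's theorem
(1914): infinitely many zeros lie on the critical line, proved in tree as
`Literature.NumberTheory.LFunctions.hardy_infinite_zeros_on_critical_line_holds`; a point `1/2 + it` is never a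
trivial zero since its real part is `1/2`. (Edwards, *Riemann's Zeta Function*, §11.1 p. 224.) [folklore] -/
theorem infinite_riemannZetaNontrivialZeros : riemannZetaNontrivialZeros.Infinite := by
  have hH : {t : ℝ | riemannZeta (1 / 2 + t * I) = 0}.Infinite :=
    hardy_infinite_zeros_on_critical_line_holds
  refine (hH.image zetaOrdinateLine_injective.injOn).mono ?_
  rintro _ ⟨t, ht, rfl⟩
  refine mem_riemannZetaNontrivialZeros.mpr ⟨ht, ?_⟩
  rintro ⟨n, hn⟩
  have h := congr_arg Complex.re hn
  rw [zetaOrdinateLine_re, show (-2 * (n + 1) : ℂ) = ((-2 * (n + 1) : ℝ) : ℂ) by push_cast; ring,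
    ofReal_re] at h
  linarith [n.cast_nonneg (α := ℝ)]

/-! ### A Hilbert–Pólya spectrum forces RH and infinitely many zeros -/

/-- A Hilbert–Pólya spectrum forces the Riemann Hypothesis: every non-trivial zero `ρ` is hit by
the family `(1/2 + iγ_i)_i` (`IsHilbertPolyaSpectrum.exists_eq_zetaOrdinateLine_of_mem`), hence
`Re ρ = 1/2`. This is the elementary "real spectrum ⇒ zeros on the line" half of the
Hilbert–Pólya heuristic (Berry–Keating, SIAM Review 41 (1999), §1). [folklore] -/
theorem IsHilbertPolyaSpectrum.riemannHypothesis {ι : Type*} {γ : ι → ℝ}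
    (hγ : IsHilbertPolyaSpectrum γ) : RiemannHypothesis := by
  intro s hs htriv _
  obtain ⟨i, hi⟩ :=
    hγ.exists_eq_zetaOrdinateLine_of_mem (mem_riemannZetaNontrivialZeros.mpr ⟨hs, htriv⟩)
  rw [← hi, zetaOrdinateLine_re]

/-- Every fibre `{i | 1/2 + iγ_i = z}` of a Hilbert–Pólya spectrum is finite (its cardinality is
a natural number, the order of vanishing of `ζ` at `z`, or `0`). [folklore] -/
theorem IsHilbertPolyaSpectrum.finite_fiber {ι : Type*} {γ : ι → ℝ}
    (hγ : IsHilbertPolyaSpectrum γ) (z : ℂ) : {i | zetaOrdinateLine (γ i) = z}.Finite := by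
  have h := hγ z
  by_cases hz : z ∈ riemannZetaNontrivialZeros
  · rw [indicator_of_mem hz] at h
    exact finite_of_encard_eq_coe h
  · rw [indicator_of_notMem hz, encard_eq_zero] at h
    rw [h]
    exact finite_empty

/-- A Hilbert–Pólya spectrum on an *infinite* index type forces infinitely many non-trivial zeros
of `ζ`: the index type is the union of the finite fibres over the non-trivial zeros. (So the
surrogate genuinely depends on the infinitude of the non-trivial zeros — a theorem, e.g. Hardy 1914
or Riemann–von Mangoldt, but not one Mathlib has.) [folklore] -/
theorem IsHilbertPolyaSpectrum.infinite_riemannZetaNontrivialZeros {ι : Type*} [Infinite ι]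
    {γ : ι → ℝ} (hγ : IsHilbertPolyaSpectrum γ) : riemannZetaNontrivialZeros.Infinite := by
  intro hfin
  have hpre : ((fun i => zetaOrdinateLine (γ i)) ⁻¹' riemannZetaNontrivialZeros).Finite :=
    hfin.preimage' fun z _ => hγ.finite_fiber z
  exact infinite_univ (hpre.subset fun i _ => hγ.zetaOrdinateLine_mem i)

/-- A Hilbert basis of `ℓ²(ℕ, ℂ)` is indexed by an infinite type: otherwise `ℓ²(ℕ, ℂ)` would be
finite-dimensional (`HilbertBasis.toOrthonormalBasis`), contradicting the linear independence of
its standard (orthonormal) basis indexed by `ℕ`. [folklore] -/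
theorem infinite_of_hilbertBasis {ι : Type*} (b : HilbertBasis ι ℂ ℓ²(ℕ, ℂ)) : Infinite ι := by
  refine not_finite_iff_infinite.mp fun hfin => ?_
  cases nonempty_fintype ι
  haveI : Module.Finite ℂ ℓ²(ℕ, ℂ) := Module.Finite.of_basis b.toOrthonormalBasis.toBasis
  haveI : Finite ℕ :=
    (default : HilbertBasis ℕ ℂ ℓ²(ℕ, ℂ)).orthonormal.linearIndependent.finite
  exact not_finite ℕ

/-- A Hilbert–Pólya operator on `ℓ²(ℕ, ℂ)` forces RH and infinitely many non-trivial zeros. [folklore] -/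
theorem _root_.LinearPMap.IsHilbertPolyaOperator.riemannHypothesis_and_infinite
    {A : ℓ²(ℕ, ℂ) →ₗ.[ℂ] ℓ²(ℕ, ℂ)} (hA : A.IsHilbertPolyaOperator) :
    RiemannHypothesis ∧ riemannZetaNontrivialZeros.Infinite := by
  obtain ⟨ι, b, γ, -, hγ⟩ := hA
  haveI := infinite_of_hilbertBasis b
  exact ⟨hγ.riemannHypothesis, hγ.infinite_riemannZetaNontrivialZeros⟩

/-! ### Under RH: the tautological diagonal operator -/

/-- Under RH, a non-trivial zero `ρ` is the point `1/2 + i·Im ρ` of the critical line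
(`ρ ≠ 1` because `ζ(1) ≠ 0`, Mathlib `riemannZeta_one_ne_zero`). [folklore] -/
theorem zetaOrdinateLine_im_eq_of_riemannHypothesis (hRH : RiemannHypothesis) {ρ : ℂ}
    (hρ : ρ ∈ riemannZetaNontrivialZeros) : zetaOrdinateLine ρ.im = ρ := by
  obtain ⟨h0, htriv⟩ := mem_riemannZetaNontrivialZeros.mp hρ
  have h1 : ρ ≠ 1 := by
    rintro rfl
    exact riemannZeta_one_ne_zero h0
  apply Complex.ext
  · rw [zetaOrdinateLine_re, hRH ρ h0 htriv h1]
  · rw [zetaOrdinateLine_im]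

/-- A countably infinite type indexes a Hilbert basis of `ℓ²(ℕ, ℂ)`: transport the standard
Hilbert basis of `ℓ²(ℕ, ℂ)` along a bijection with `ℕ` (Mathlib `nonempty_equiv_of_countable`,
`HilbertBasis.mk`). [folklore] -/
theorem nonempty_hilbertBasis_of_countable_of_infinite (ι : Type*) [Countable ι] [Infinite ι] :
    Nonempty (HilbertBasis ι ℂ ℓ²(ℕ, ℂ)) := by
  obtain ⟨e⟩ := (nonempty_equiv_of_countable : Nonempty (ι ≃ ℕ))
  let std : HilbertBasis ℕ ℂ ℓ²(ℕ, ℂ) := default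
  refine ⟨HilbertBasis.mk (std.orthonormal.comp e e.injective) ?_⟩
  rw [e.surjective.range_comp]
  exact std.dense_span.ge

/-- Under RH, the family `Im ρ` indexed by the pairs `(ρ, k)`, `ρ` a non-trivial zero and
`k < ord_ρ ζ`, is a Hilbert–Pólya spectrum: the fibre of `(ρ, k) ↦ 1/2 + i Im ρ = ρ` over a
non-trivial zero `z` is `{z} × Fin (ord_z ζ)`, of cardinality the multiplicity of `z`, and is
empty over any other point. [folklore] -/
theorem isHilbertPolyaSpectrum_of_riemannHypothesis (hRH : RiemannHypothesis) :
    IsHilbertPolyaSpectrum (fun i : (Σ ρ : riemannZetaNontrivialZeros,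
      Fin (analyticOrderNatAt riemannZeta ρ)) => (i.1 : ℂ).im) := by
  intro z
  by_cases hz : z ∈ riemannZetaNontrivialZeros
  · rw [indicator_of_mem hz]
    have hset : {i : Σ ρ : riemannZetaNontrivialZeros, Fin (analyticOrderNatAt riemannZeta ρ) |
        zetaOrdinateLine (i.1 : ℂ).im = z} = range (Sigma.mk ⟨z, hz⟩) := by
      ext ⟨ρ, k⟩
      simp only [mem_setOf_eq, mem_range]
      rw [zetaOrdinateLine_im_eq_of_riemannHypothesis hRH ρ.2]
      constructor
      · intro h
        obtain rfl : ρ = ⟨z, hz⟩ := Subtype.ext h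
        exact ⟨k, rfl⟩
      · rintro ⟨k', hk'⟩
        have h1 : (⟨z, hz⟩ : riemannZetaNontrivialZeros) = ρ := congr_arg Sigma.fst hk'
        rw [← h1]
    rw [hset, ← image_univ, sigma_mk_injective.encard_image, encard_univ,
      ENat.card_eq_coe_fintype_card, Fintype.card_fin]
  · rw [indicator_of_notMem hz, encard_eq_zero, eq_empty_iff_forall_notMem]
    rintro ⟨ρ, k⟩ h
    rw [mem_setOf_eq, zetaOrdinateLine_im_eq_of_riemannHypothesis hRH ρ.2] at h
    exact hz (h ▸ ρ.2)

/-- Under RH, and given infinitely many non-trivial zeros, there is a Hilbert–Pólya operator on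
`ℓ²(ℕ, ℂ)`: the diagonal operator with symbol `Im ρ` in a Hilbert basis indexed by the countably
infinite type of pairs `(ρ, k)`, `ρ` a non-trivial zero, `k < ord_ρ ζ` (the tautological
construction "enumerate the zeros with multiplicity"; Berry–Keating, SIAM Review 41 (1999), §1,
p. 237: "if the Riemann hypothesis is true, all the (infinitely many) `t_n` are real"). [folklore] -/
theorem exists_isHilbertPolyaOperator_of_riemannHypothesis (hRH : RiemannHypothesis)
    (hinf : riemannZetaNontrivialZeros.Infinite) :
    ∃ A : ℓ²(ℕ, ℂ) →ₗ.[ℂ] ℓ²(ℕ, ℂ), A.IsHilbertPolyaOperator := by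
  haveI : Countable riemannZetaNontrivialZeros :=
    (riemannZetaNontrivialZeros_countable : riemannZetaNontrivialZeros.Countable).to_subtype
  haveI : Infinite riemannZetaNontrivialZeros := hinf.to_subtype
  haveI : Infinite (Σ ρ : riemannZetaNontrivialZeros, Fin (analyticOrderNatAt riemannZeta ρ)) :=
    Infinite.of_injective
      (fun ρ : riemannZetaNontrivialZeros =>
        (⟨ρ, ⟨0, Nat.pos_of_ne_zero (analyticOrderNatAt_riemannZeta_ne_zero ρ.2)⟩⟩ :
          Σ ρ : riemannZetaNontrivialZeros, Fin (analyticOrderNatAt riemannZeta ρ)))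
      fun ρ ρ' h => congr_arg Sigma.fst h
  obtain ⟨b⟩ := nonempty_hilbertBasis_of_countable_of_infinite
    (Σ ρ : riemannZetaNontrivialZeros, Fin (analyticOrderNatAt riemannZeta ρ))
  exact ⟨_, _, b, fun i => (i.1 : ℂ).im, rfl, isHilbertPolyaSpectrum_of_riemannHypothesis hRH⟩

/-! ### The equivalences -/

/-- The Hilbert–Pólya surrogate is equivalent to RH *together with* the infinitude of the
non-trivial zeros (pure glue over the definitions; no analytic input beyond Mathlib). [folklore] -/
theorem hilbertPolyaConjecture_iff_riemannHypothesis_and_infinite :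
    HilbertPolyaConjecture ↔ RiemannHypothesis ∧ riemannZetaNontrivialZeros.Infinite := by
  constructor
  · rintro ⟨A, hA⟩
    exact hA.riemannHypothesis_and_infinite
  · rintro ⟨hRH, hinf⟩
    exact exists_isHilbertPolyaOperator_of_riemannHypothesis hRH hinf

/-- **The formal Hilbert–Pólya surrogate is equivalent to the Riemann Hypothesis**
(`HilbertPolyaConjecture ↔ RiemannHypothesis`), unconditionally: a Hilbert–Pólya spectrum forces
all non-trivial zeros onto the critical line, and conversely under RH the non-trivial zeros
(countably many, each of finite multiplicity, infinitely many by Hardy 1914 —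
`Literature.NumberTheory.LFunctions.hardy_infinite_zeros_on_critical_line_holds`) are enumerated with multiplicity by a
countably infinite type carrying a Hilbert basis of `ℓ²(ℕ, ℂ)`, giving the tautological diagonal
operator. In particular the named statement `HilbertPolyaConjecture` is open exactly as RH is
(Berry–Keating, SIAM Review 41 (1999), §1 pp. 237–238; Edwards 1974, §11.1 p. 224). [folklore] -/
theorem hilbertPolyaConjecture_iff_riemannHypothesis : HilbertPolyaConjecture ↔ RiemannHypothesis :=
  hilbertPolyaConjecture_iff_riemannHypothesis_and_infinite.trans
    (and_iff_left infinite_riemannZetaNontrivialZeros)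

/-- The Hilbert–Pólya surrogate implies the Riemann Hypothesis. [folklore] -/
theorem HilbertPolyaConjecture.riemannHypothesis (h : HilbertPolyaConjecture) : RiemannHypothesis :=
  hilbertPolyaConjecture_iff_riemannHypothesis.mp h

/-- The Riemann Hypothesis implies the Hilbert–Pólya surrogate. [folklore] -/
theorem hilbertPolyaConjecture_of_riemannHypothesis (h : RiemannHypothesis) :
    HilbertPolyaConjecture :=
  hilbertPolyaConjecture_iff_riemannHypothesis.mpr h

/-- Under RH the Hilbert–Pólya spectrum condition may be checked on the critical line only: `γ` is
a Hilbert–Pólya spectrum iff for every real `t` the fibre `{i | γ_i = t}` has cardinality the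
multiplicity of `1/2 + it` as a non-trivial zero (`0` if it is not one). The forward direction is
unconditional (`zetaOrdinateLine` is injective); the converse uses that under RH every non-trivial
zero is of the form `1/2 + it`. [folklore] -/
theorem isHilbertPolyaSpectrum_iff_of_riemannHypothesis (hRH : RiemannHypothesis) {ι : Type*}
    (γ : ι → ℝ) :
    IsHilbertPolyaSpectrum γ ↔ ∀ t : ℝ, {i | γ i = t}.encard =
      riemannZetaNontrivialZeros.indicator (fun z => (analyticOrderNatAt riemannZeta z : ℕ∞))
        (zetaOrdinateLine t) := by
  have key : ∀ t : ℝ, {i | γ i = t} = {i | zetaOrdinateLine (γ i) = zetaOrdinateLine t} :=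
    fun t => Set.ext fun i => zetaOrdinateLine_injective.eq_iff.symm
  constructor
  · intro hγ t
    rw [key]
    exact hγ _
  · intro h z
    by_cases hz : z ∈ riemannZetaNontrivialZeros
    · rw [← zetaOrdinateLine_im_eq_of_riemannHypothesis hRH hz, ← key]
      exact h z.im
    · rw [indicator_of_notMem hz, encard_eq_zero, eq_empty_iff_forall_notMem]
      intro i hi
      rw [mem_setOf_eq] at hi
      have hγi := h (γ i)
      rw [hi, indicator_of_notMem hz, encard_eq_zero, eq_empty_iff_forall_notMem] at hγi
      exact hγi i rfl

end Literature.Analysis.UnboundedOperators
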